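import Summits.Ventures.CertifiedManyBodySolver.Certificates.HubbardSquare_kdwidth_M130A_T1
import Summits.Ventures.CertifiedManyBodySolver.Certificates.HubbardSquare_kdwidth_M130A_T2
import Summits.Ventures.CertifiedManyBodySolver.Certificates.HubbardSquare_kdwidth_M130A_T3
import Summits.Ventures.CertifiedManyBodySolver.Certificates.HubbardSquare_transportClosureCells_M19Va_B
import HarnessLib

/-!
# Ventures/CertifiedManyBodySolver — Certificates/HubbardSquare_kdwidth_M130A_H9.lean (hubbard-box-p2 g18: KD-WIDTH M130A, bridging lemmas part 9 of 9)

Per-word bridging: each cited landed word (its premises supplied from the bundle `kdw_M130A_Premises`) ⇒ `WordRec.Holds e₀` of its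
record in `HubbardSquare_kdwidth_M130A_T*`. Proof shape: the record's corner functions equal the word's literal box (`fin_cases; norm_num`), apply the
word, `norm_num [record, mlEval_vec8]` on both sides, `linarith`. WHAT THIS IS NOT: a new word.
-/

noncomputable section

namespace Summit.Ventures.CertifiedManyBodySolver.Certificates

open Literature.MathematicalPhysics.QuantumLattice Literature.MathematicalPhysics.QuantumLattice.ThermodynamicLimit
open Matrix Finset Filter Topology
open Literature.MathematicalPhysics.QuantumLattice
open Literature.MathematicalPhysics.QuantumLattice.ThermodynamicLimit
open Literature.MathematicalPhysics.QuantumLattice.TTPrimeFree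
open Literature.Probability.LatticeModels
open scoped ComplexOrder ComplexConjugate Topology BigOperators
open Summit.Ventures.CertifiedManyBodySolver.Certificates
open Summit.Ventures.CertifiedManyBodySolver.Certificates.BoxWordGC
open Summit.Ventures.CertifiedManyBodySolver.Certificates.DerivedNTangentR473Sym
open Summit.Ventures.CertifiedManyBodySolver.Certificates.DerivedNTangentR504Sym
open Literature.Computation.Certificates.BoxCovering
open Literature.Analysis.ValidatedNumerics (KdCert)

/-- Word 269 holds for `e₀`: the landed theorem `tcc_M19Va_c19_nchord_mlword_Icc`. -/
theorem kdw_M130A_w269_holds (H : kdw_M130A_Premises) : kdw_M130A_w269.Holds (fun θ : Fin 3 → ℝ => energyDensityTT' 1 (θ 1) (θ 0) (θ 2)) := by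
  intro θ hθ
  have eL : (fun k : Fin 3 => ((kdw_M130A_w269.lo k : ℚ) : ℝ)) = (![10, -9/20, 13/16] : Fin 3 → ℝ) := by funext k; fin_cases k <;> norm_num [kdw_M130A_w269]
  have eH : (fun k : Fin 3 => ((kdw_M130A_w269.hi k : ℚ) : ℝ)) = (![21/2, -43/100, 89/100] : Fin 3 → ℝ) := by funext k; fin_cases k <;> norm_num [kdw_M130A_w269]
  have hw := Summit.Ventures.CertifiedManyBodySolver.Certificates.tcc_M19Va_c19_nchord_mlword_Icc H.hsY17o2m55 H.hsX12m40 H.hsX17o2m40 H.hs10m45n1 H.h412 H.h470 H.hP450 H.hs11m45n7o8 H.hs10m40n1 H.hs11m40n7o8 θ (by rw [← eL, ← eH]; exact hθ)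
  constructor
  · have h := hw.1; norm_num [kdw_M130A_w269, mlEval_vec8] at h ⊢; linarith
  · have h := hw.2; norm_num [kdw_M130A_w269, mlEval_vec8] at h ⊢; linarith

end Summit.Ventures.CertifiedManyBodySolver.Certificates

end
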